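/-
Copyright (c) 2026 the pub-hodgecm-mathlib formalisation cell (harness21).  Prover seat hodgecm-mathlib-K2E5-p17 (g8), Track B «K2-LIT»,
#184♮ = hLiu418 = `stmt-HodgeConjecture-24832`; socket #41 — THE TOP, edition 8 «KIND W AT THE WHITTAKER LEVEL»: edition 7 (P = {½} ★ p861474, KIND 1 ★ p861664, `hRKc` ★ p861715) with KIND W's Euler identity stated for
`whittakerDelta νN S (f s) h` (β-free) and transported to the Fourier coefficient inside by ★ Φ2 + ★ ed. 4a′
(author of record, LEAD F0P6-plan (g14) BATCH #46 (a) ∕ #49).  THEOREMS ONLY; NO `Lines` import.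
-/
import Summits.HodgeConjecture.HodgeConjecture.Theorems.K2LiuSiegelEisensteinConstantTermFiniteness        -- ★ ed. 4a′ (this seat) ⊇ ed. 4a ⊇ ed. 3b
import Summits.HodgeConjecture.HodgeConjecture.Theorems.K2LiuSiegelEisensteinKindZeroBigCellLetters         -- ★ p861499 `standardFamily_growth`
import Summits.HodgeConjecture.HodgeConjecture.Theorems.K2LiuSiegelEisensteinBigCellTermPackageCM          -- ★ p861474 `exists_bigCell_termPackage_cm` (P₈ = {½}, scalar b^S∕a^S)
import Summits.HodgeConjecture.HodgeConjecture.Theorems.K2LiuSiegelEisensteinRankOneTermPackageInstanceWeighted  -- ★ p861664 `exists_kindOne_packages_sixLetters` (KIND 1 by name)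
import Summits.HodgeConjecture.HodgeConjecture.Theorems.K2LiuFourierCoeffDeltaContinuous                 -- ★ p861715 `continuous_fourierCoeffDelta_eisenstein{Series,Family}Delta` (`hRKc` paid)
import Summits.HodgeConjecture.HodgeConjecture.Theorems.K2LiuSiegelEisensteinContinuationTopEight             -- ★ p861775 edition 8 (this file = edition 8 with the carrier built inside)
import Summits.HodgeConjecture.HodgeConjecture.Theorems.K2LiuIntertwiningConvergesOfParabolic          -- ★ `exists_wq`
import Summits.HodgeConjecture.HodgeConjecture.Theorems.K2LiuUnipotentCocompact                        -- ★ (C0) `exists_isCompact_cover_unipDelta`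
import Summits.HodgeConjecture.HodgeConjecture.Theorems.K2LiuUnipotentCoveringWeight                  -- ★ `exists_isCoveringWeight_unipDeltaRat_lintegral_ne_top`
import Summits.HodgeConjecture.HodgeConjecture.Theorems.K2LiuUnipDeltaConjMeasurePreserving            -- ★ `lintegral_ne_zero_of_isCoveringWeight`
import Summits.HodgeConjecture.HodgeConjecture.Theorems.K2LiuSiegelUnipotentHaarPinned                 -- ★ `locallyCompactSpace_unipDelta`
import Summits.HodgeConjecture.HodgeConjecture.Theorems.K2LiuSiegelEisensteinWhittakerTermPackageFixedCarrier  -- ★ p861446 `exists_whittaker_packages_fourierCoeff_fixedCarrier`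
import Summits.HodgeConjecture.HodgeConjecture.Theorems.K2LiuSiegelEisensteinWhittakerMajorant              -- ★ p861512 `whittaker_majorant∕summedGrowth_of_weightedGrowth`
import HarnessLib

/-!
# Crux `HLiu418`, socket #41 — THE TOP, edition 9 «CARRIER INSIDE»: edition 8 with the unipotent carrier `(N_Δ(𝔸) Borel, νN := haar, β an N_Δ(L⁺)-covering
# weight ≤ 𝟙_K of positive finite mass, K a compact N_Δ(L⁺)-cover, wq the rational Weyl presentation)` BUILT INSIDE and the three carrier-dependent kinds taken as
# PACKAGES quantified over the carrier — the head's binders are the socket prefix + the payers' named analytic letters only (the END shape)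

Cell `hodgecm-mathlib`, crux item hLiu418 = `stmt-HodgeConjecture-24832` (helper lane until the typist's tie; count-neutral).

Over ★ edition 3b `siegelEisensteinContinuation_of_kinds_fixedCarrier` (carrier a binder: `νN` Haar on `N_Δ(𝔸)`, `β` a covering weight with `β ≤ 𝟙_K`, `K` compact, `0 < ∫β < ∞` — the
tie builds it as ★ edition 2 does), THIS EDITION discharges BY NAME: KIND 0's identity-cell growth `hfgr` (★ p861499 `standardFamily_growth`), O41.4's finiteness `hH` (★ ed. 4a′
`lintegral_tsum_enorm_mul_weight_ne_top`), the big-cell letters `E₈` (★ p861499 `exists_E₈` over ★ p861423 `exists_bigCell_termPackage`), the KIND-0 assembly (★ ed. 4a); KIND W's per-`S`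
packages (★ p861446 `exists_whittaker_packages_fourierCoeff_fixedCarrier`) and lattice letters (★ p861512).  WHAT REMAINS BY VALUE (the named surface of record): the pole set `P`;
KIND 0: the big-cell SCALAR NORMALISATION `(r, G, a)` with `(∏(s−p))·r = G` holomorphic, `r·a = 1` (★ O41.6 `a^S∕b^S` at the frame, ★ p861474) and the CONTINUATION `(E, hEd, hEeq)` of
`a(s)·M(s)f_s(h)` (rows G6-fin∕G6-arch), the rational Weyl presentation `(wq, hwq)` (★ O41.4's), the MIDDLE package `E₇` ((u-0c), un-normalised currency); KIND 1: the per-`S` packages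
`(Ec₁, h1off, hd₁, hc₁, hcoef₁)` ((u-1a), ★ p861061 at `X := H(𝔸)`) and the weighted growth `(w₁, h1g)` ((u-1b)); KIND W: the factor data `(WT, G_W, hWTd, hGWd)`, the weighted growth `hg`,
the Euler identity `hRK` with its continuity `hRKc` (rows G1–G4 + the G2 glue) and a summable weight `w`.
HEAD **`siegelEisensteinContinuation_assembled`** ⇒ socket #41's body BYTES VERBATIM.
Sources: [Tan1999, §1 Main Theorem; §4 Props. 4.1, 4.4, 4.8]; [MoeglinWaldspurger1995, II.1.7, IV.1.8–IV.1.11]; [KudlaRallis1994, §1–§2]; [Liu2021, Lem. B.10 (2), B.12].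
HONEST LABEL.  Count-neutral helper until tied; `HC_CM` is proved only modulo the 7 printed citations (2 remaining named inputs: hLiu418 = `stmt-HodgeConjecture-24832`,
h413 = `stmt-HodgeConjecture-24833`) until rung 0 closes.
-/

set_option autoImplicit false
set_option linter.dupNamespace false -- the mandated namespace repeats `HodgeConjecture.HodgeConjecture`

noncomputable section

open scoped Matrix Topology ENNReal NNReal BigOperators
open NumberField IsDedekindDomain MeasureTheory Filter
open Literature.NumberTheory.Automorphic Literature.NumberTheory.GaloisRepresentations
open Literature.NumberTheory.GelbartRogawski1991 Literature.NumberTheory.GelbartRogawski1991.GRConstruction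
open Literature.NumberTheory.K2Lit.SiegelDoubled Literature.MeasureTheory.Group
open Literature.NumberTheory.Automorphic.IdeleClassGroup

namespace Summit.HodgeConjecture.HodgeConjecture.Cruxes.HLiu418.K2LiuSiegelEisensteinContinuationTopNine

open K2LiuSiegelUnipotentFourierDefs K2LiuSiegelEisensteinContinuationTopKinds K2LiuSiegelEisensteinConstantTermPackage K2LiuSiegelEisensteinConstantTermFiniteness
open K2LiuSiegelEisensteinKindZeroBigCellLetters (standardFamily_growth)
open K2LiuSiegelEisensteinBigCellTermPackageCM (exists_bigCell_termPackage_cm)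
open K2LiuSiegelEisensteinRankOneTermPackageInstanceWeighted (exists_kindOne_packages_sixLetters)
open K2LiuFourierCoeffDeltaContinuous (continuous_fourierCoeffDelta_eisensteinSeriesDelta continuous_fourierCoeffDelta_eisensteinFamilyDelta)
open K2LiuSiegelEisensteinContinuationTopEight (siegelEisensteinContinuation_eight)
open K2LiuUnipotentCocompact (exists_isCompact_cover_unipDelta)
open K2LiuUnipotentCoveringWeight (exists_isCoveringWeight_unipDeltaRat_lintegral_ne_top countable_unipDeltaRat)
open K2LiuUnipDeltaConjMeasurePreserving (lintegral_ne_zero_of_isCoveringWeight)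
open K2LiuSiegelUnipotentHaarPinned (locallyCompactSpace_unipDelta)
open K2LiuSiegelEisensteinWhittakerTermPackageFixedCarrier (exists_whittaker_packages_fourierCoeff_fixedCarrier)
open K2LiuSiegelEisensteinWhittakerMajorant (whittaker_majorant_of_weightedGrowth whittaker_summedGrowth_of_weightedGrowth)

open Classical in
/-- **SOCKET #41, CARRIER INSIDE (edition 9 — the END shape).**  Binders: the socket prefix; KIND 0 = the place set `S` of the scalar + the big-cell continuation
PACKAGE `hE : ∀ ‹Borel› νN Haar, ∃ E, hEd ∧ hEeq` + the middle-term PACKAGE `hE₇ : ∀ wq hwq ‹Borel› νN Haar β (covering, mass ≠ 0, ≠ ⊤) K (compact, β ≤ 𝟙_K), ∃ E₇, h7d ∧ h7c ∧ h7eq ∧ h7g`;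
KIND 1 = ★ p861664's carrier-free letters (by value); KIND W = the PACKAGE `hW : ∀ ‹Borel› νN Haar, ∃ WT GW w, hWTd ∧ hGWd ∧ hw0 ∧ hws ∧ hg ∧ hRKW`.  Inside: `borel`,
`Measure.haar`, ★ (C0) compact cover, ★ covering weight of finite mass, ★ mass ≠ 0, ★ `exists_wq`; then ★ edition 8.  THEN socket #41's `∃ P Es, (A1) ∧ … ∧ (A5)`.
[cite: Tan1999, §1 Main Theorem; §4 Props. 4.1, 4.4, 4.8] [cite: MoeglinWaldspurger1995, II.1.7, IV.1.8–IV.1.11] [cite: KudlaRallis1994, §1–§2] [cite: Liu2021, Lem. B.10 (2), B.12] -/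
theorem siegelEisensteinContinuation_nine
    (L : Type) [Field L] [NumberField L] [IsCMField L] {n : ℕ} (e : Fin 2 × Fin 1 ≃ Fin n)
    (dV : Fin 2 → L) (hdV : ∀ i, IsCMField.complexConj L (dV i) = dV i) (hdV0 : ∀ i, dV i ≠ 0)
    (dW : Fin 1 → L) (hdW : ∀ i, IsCMField.complexConj L (dW i) = dW i) (hdW0 : ∀ i, dW i ≠ 0)
    (lam : IdeleClassGroup L →ₜ* Circle) (hlam : IsConjugateSymplectic L lam) (hw : HasWeight L lam 1)
    (𝒦 : IwasawaDatum L e dV hdV dW hdW) (h𝒦 : 𝒦.IsStd) (f : ℂ → HA L e dV hdV dW hdW → ℂ)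
    (hstd : IsStandardSectionFamily 𝒦 (toHeckeCharacter L lam⁻¹) f) (hcont : ∀ s, Continuous (f s))
    -- KIND 0: ★ p861474's big-cell continuation PACKAGE `hE` over the carrier (the scalar's place set `S` by value) and the middle-term PACKAGE `hE₇` over `(wq, νN, β, K)`
    {S : Set (HeightOneSpectrum (𝓞 ↥(maximalRealSubfield L)))} (hS : S.Finite) (hur : ∀ v ∉ S, (quadraticHeckeCharCM L).IsUnramifiedAt v)
    (hE : ∀ [MeasurableSpace (unipDelta L e dV hdV dW hdW)] [BorelSpace (unipDelta L e dV hdV dW hdW)] (νN : Measure (unipDelta L e dV hdV dW hdW)) [νN.IsHaarMeasure],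
        ∃ (E : ℂ → HA L e dV hdV dW hdW → ℂ),
        (∀ x : HA L e dV hdV dW hdW, DifferentiableOn ℂ (fun s : ℂ => E s x) {s : ℂ | 0 < s.re}) ∧
        (∀ (s : ℂ) (x : HA L e dV hdV dW hdW), (n : ℝ) / 2 < s.re →
      E s x = (partialStandardL S (fun _ => {1}) (2 * s + 1) * partialStandardL S (fun v => {(quadraticHeckeCharCM L).valueAtUniformizer v}) (2 * s + 2)) /
          (partialStandardL S (fun _ => {1}) (2 * s) * partialStandardL S (fun v => {(quadraticHeckeCharCM L).valueAtUniformizer v}) (2 * s - 1)) *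
        intertwiningDelta L e dV hdV dW hdW νN (f s) x))
    (hE₇ : ∀ (wq : unipDeltaRat L e dV hdV dW hdW → ratH L e dV hdV dW hdW)
        (hwq : ∀ ν, ((wq ν : ratH L e dV hdV dW hdW) : HA L e dV hdV dW hdW) = weylDelta L e dV hdV dW hdW * ((ν : unipDelta L e dV hdV dW hdW) : HA L e dV hdV dW hdW))
        [MeasurableSpace (unipDelta L e dV hdV dW hdW)] [BorelSpace (unipDelta L e dV hdV dW hdW)] (νN : Measure (unipDelta L e dV hdV dW hdW)) [νN.IsHaarMeasure] (β : unipDelta L e dV hdV dW hdW → ℝ≥0∞),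
        IsCoveringWeight (unipDeltaRat L e dV hdV dW hdW) β → ∫⁻ u, β u ∂νN ≠ 0 → ∫⁻ u, β u ∂νN ≠ ∞ →
        ∀ (K : Set (unipDelta L e dV hdV dW hdW)), IsCompact K → (∀ u, β u ≤ K.indicator 1 u) →
        ∃ (E₇ : ℂ → HA L e dV hdV dW hdW → ℂ),
        (∀ h : HA L e dV hdV dW hdW, DifferentiableOn ℂ (fun s => E₇ s h) {s : ℂ | 0 < s.re}) ∧
        (∀ s : ℂ, 0 < s.re → Continuous (E₇ s)) ∧
        (∀ (s : ℂ) (h : HA L e dV hdV dW hdW), (n : ℝ) / 2 < s.re →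
      E₇ s h = (∏ p ∈ ({(1 / 2 : ℂ)} : Finset ℂ), (s - p)) * ∫ u, (β u).toReal •
        (∑' q : ↥(({Quotient.mk (MulAction.orbitRel (siegelDeltaRat L e dV hdV dW hdW) (ratH L e dV hdV dW hdW)) 1} ∪
            Set.range (fun ν : unipDeltaRat L e dV hdV dW hdW =>
              (Quotient.mk (MulAction.orbitRel (siegelDeltaRat L e dV hdV dW hdW) (ratH L e dV hdV dW hdW)) (wq ν) :
                SiegelDeltaQuot L e dV hdV dW hdW)))ᶜ : Set (SiegelDeltaQuot L e dV hdV dW hdW)),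
          f s ((((Quotient.out (q : SiegelDeltaQuot L e dV hdV dW hdW) : ratH L e dV hdV dW hdW) : HA L e dV hdV dW hdW)) *
            ((u : HA L e dV hdV dW hdW) * h))) ∂νN) ∧
        (∀ z : ℂ, 0 < z.re → ∃ C A r : ℝ, 0 < r ∧ ∀ s : ℂ, dist s z < r → ∀ h : HA L e dV hdV dW hdW,
      ‖E₇ s h‖ ≤ C * adelicHeightGL (n + n) L (h : GL (Fin (n + n)) (AdeleRing (𝓞 L) L)) ^ A))
    -- KIND 1: ★ p861664's letters — term data, weights, weighted growth, decay, coefficient identity (carrier- AND Borel-structure-generic; `hRKc` is ★ p861715)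
    (ι : skewMatrices ((IsCMField.complexConj L : L ≃ₐ[Fp L] L) : L →+* L) ((gramR L e dV hdV dW hdW).map (algebraMap (Fp L) L)) → Type) [∀ S, Fintype (ι S)]
    (a : ∀ S, ι S → ℂ → HA L e dV hdV dW hdW → ℂ)
    (had : ∀ S j x, DifferentiableOn ℂ (fun s => a S j s x) {s : ℂ | 0 < s.re})
    (ρb ρa G : skewMatrices ((IsCMField.complexConj L : L ≃ₐ[Fp L] L) : L →+* L) ((gramR L e dV hdV dW hdW).map (algebraMap (Fp L) L)) → ℂ → ℂ)
    (hρb : ∀ S, DifferentiableOn ℂ (ρb S) {s : ℂ | 0 < s.re})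
    (hG : ∀ S, DifferentiableOn ℂ (G S) {s : ℂ | 0 < s.re}) (hGρ : ∀ S, ∀ s : ℂ, 0 < s.re → s ≠ 1 / 2 → G S s = (s - 1 / 2) * ρa S s)
    (Eb Ea : ∀ S, ι S → ℂ → HA L e dV hdV dW hdW → ℂ)
    (hEb : ∀ S j x, DifferentiableOn ℂ (fun s => Eb S j s x) {s : ℂ | 0 < s.re})
    (hEa : ∀ S j x, DifferentiableOn ℂ (fun s => Ea S j s x) {s : ℂ | 0 < s.re})
    (ua ub uG : skewMatrices ((IsCMField.complexConj L : L ≃ₐ[Fp L] L) : L →+* L) ((gramR L e dV hdV dW hdW).map (algebraMap (Fp L) L)) → ℝ)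
    (hua : ∀ S, 0 ≤ ua S) (hub : ∀ S, 0 ≤ ub S) (huG : ∀ S, 0 ≤ uG S) (N₀ : ℕ) (hN₀ : ∀ S, Fintype.card (ι S) ≤ N₀)
    (hag : ∀ z : ℂ, 0 < z.re → ∃ C A r : ℝ, 0 ≤ C ∧ 0 ≤ A ∧ 0 < r ∧ ∀ S j (s : ℂ), dist s z < r → ∀ x : HA L e dV hdV dW hdW,
      ‖a S j s x‖ ≤ C * ua S * adelicHeightGL (n + n) L (x : GL (Fin (n + n)) (AdeleRing (𝓞 L) L)) ^ A)
    (hbg : ∀ z : ℂ, 0 < z.re → ∃ C A r : ℝ, 0 ≤ C ∧ 0 ≤ A ∧ 0 < r ∧ ∀ S j (s : ℂ), dist s z < r → ∀ x : HA L e dV hdV dW hdW,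
      ‖ρb S s * Eb S j s x‖ ≤ C * ub S * adelicHeightGL (n + n) L (x : GL (Fin (n + n)) (AdeleRing (𝓞 L) L)) ^ A)
    (haG : ∀ z : ℂ, 0 < z.re → ∃ C A r : ℝ, 0 ≤ C ∧ 0 ≤ A ∧ 0 < r ∧ ∀ S j (s : ℂ), dist s z < r → ∀ x : HA L e dV hdV dW hdW,
      ‖G S s * Ea S j s x‖ ≤ C * uG S * adelicHeightGL (n + n) L (x : GL (Fin (n + n)) (AdeleRing (𝓞 L) L)) ^ A)
    (hws₁ : Summable fun S => ua S * (ub S + uG S))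
    (hRK₁ : ∀ S : skewMatrices ((IsCMField.complexConj L : L ≃ₐ[Fp L] L) : L →+* L) ((gramR L e dV hdV dW hdW).map (algebraMap (Fp L) L)),
      (S : Matrix (Fin n) (Fin n) L) ≠ 0 → (S : Matrix (Fin n) (Fin n) L).det = 0 →
      ∀ [MeasurableSpace (unipDelta L e dV hdV dW hdW)] [BorelSpace (unipDelta L e dV hdV dW hdW)] (νN : Measure (unipDelta L e dV hdV dW hdW)) [νN.IsHaarMeasure] (β : unipDelta L e dV hdV dW hdW → ℝ≥0∞),
      IsCoveringWeight (unipDeltaRat L e dV hdV dW hdW) β → ∫⁻ u, β u ∂νN ≠ 0 → ∫⁻ u, β u ∂νN ≠ ∞ →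
      ∀ (s : ℂ) (h : HA L e dV hdV dW hdW), (n : ℝ) / 2 < s.re →
        fourierCoeffDelta L e dV hdV dW hdW νN β (S : Matrix (Fin n) (Fin n) L) (eisensteinFamilyDelta L e dV hdV dW hdW f s) h =
          ∑ j, a S j s h * (ρb S s * Eb S j s h + ρa S s * Ea S j s h))
    -- KIND W: the PACKAGE `hW` over the carrier — factor data, weighted growth, β-free Euler identity for the Whittaker functional
    (hW : ∀ [MeasurableSpace (unipDelta L e dV hdV dW hdW)] [BorelSpace (unipDelta L e dV hdV dW hdW)] (νN : Measure (unipDelta L e dV hdV dW hdW)) [νN.IsHaarMeasure],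
        ∃ (WT GW : skewMatrices ((IsCMField.complexConj L : L ≃ₐ[Fp L] L) : L →+* L) ((gramR L e dV hdV dW hdW).map (algebraMap (Fp L) L)) → ℂ → HA L e dV hdV dW hdW → ℂ) (w : skewMatrices ((IsCMField.complexConj L : L ≃ₐ[Fp L] L) : L →+* L) ((gramR L e dV hdV dW hdW).map (algebraMap (Fp L) L)) → ℝ),
        (∀ S (h : HA L e dV hdV dW hdW), DifferentiableOn ℂ (fun s => WT S s h) {s : ℂ | 0 < s.re}) ∧
        (∀ S (h : HA L e dV hdV dW hdW), DifferentiableOn ℂ (fun s => GW S s h) {s : ℂ | 0 < s.re}) ∧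
        (∀ S, 0 ≤ w S) ∧
        (Summable w) ∧
        (∀ z : ℂ, 0 < z.re → ∃ C A r : ℝ, 0 ≤ C ∧ 0 ≤ A ∧ 0 < r ∧ ∀ S (s : ℂ), dist s z < r → ∀ h : HA L e dV hdV dW hdW,
      ‖WT S s h * GW S s h‖ ≤ C * w S * adelicHeightGL (n + n) L (h : GL (Fin (n + n)) (AdeleRing (𝓞 L) L)) ^ A) ∧
        (∀ S : skewMatrices ((IsCMField.complexConj L : L ≃ₐ[Fp L] L) : L →+* L) ((gramR L e dV hdV dW hdW).map (algebraMap (Fp L) L)),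
      (S : Matrix (Fin n) (Fin n) L).det ≠ 0 → ∀ (s : ℂ) (h : HA L e dV hdV dW hdW), (n : ℝ) / 2 < s.re →
        whittakerDelta L e dV hdV dW hdW νN (S : Matrix (Fin n) (Fin n) L) (f s) h = WT S s h * GW S s h)) :
    ∃ (P : Finset ℂ) (Es : ℂ → HA L e dV hdV dW hdW → ℂ),
      (∀ h : HA L e dV hdV dW hdW, DifferentiableOn ℂ (fun s => Es s h) {s : ℂ | 0 < s.re}) ∧
      (∀ s : ℂ, 0 < s.re → Continuous (Es s)) ∧
      (∀ s : ℂ, 0 < s.re → ∀ (γ : ratH L e dV hdV dW hdW) (h : HA L e dV hdV dW hdW),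
        Es s ((γ : HA L e dV hdV dW hdW) * h) = Es s h) ∧
      (∀ (s : ℂ) (h : HA L e dV hdV dW hdW), (n : ℝ) / 2 < s.re →
        Es s h = (∏ p ∈ P, (s - p)) * eisensteinFamilyDelta L e dV hdV dW hdW f s h) ∧
      (∀ z : ℂ, 0 < z.re → ∃ C A r : ℝ, 0 < r ∧ ∀ s : ℂ, dist s z < r → ∀ h : HA L e dV hdV dW hdW,
        ‖Es s h‖ ≤ C * adelicHeightGL (n + n) L (h : GL (Fin (n + n)) (AdeleRing (𝓞 L) L)) ^ A) := by
  -- the carrier, built inside (as ★ edition 2 `…_of_rows₂`)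
  letI : MeasurableSpace (unipDelta L e dV hdV dW hdW) := borel _
  haveI : BorelSpace (unipDelta L e dV hdV dW hdW) := ⟨rfl⟩
  haveI : LocallyCompactSpace (unipDelta L e dV hdV dW hdW) := locallyCompactSpace_unipDelta L e dV hdV dW hdW
  haveI : Countable (unipDeltaRat L e dV hdV dW hdW) := countable_unipDeltaRat L e dV hdV dW hdW
  obtain ⟨K, hK, hcover⟩ := exists_isCompact_cover_unipDelta L e dV hdV dW hdW hdV0 hdW0
  obtain ⟨β, hβ, -, hβK, hβtop⟩ :=
    exists_isCoveringWeight_unipDeltaRat_lintegral_ne_top L e dV hdV dW hdW (Measure.haar : Measure (unipDelta L e dV hdV dW hdW)) hK hcover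
  have hν : (Measure.haar : Measure (unipDelta L e dV hdV dW hdW)) ≠ 0 := by
    intro h0
    have h1 := isOpen_univ.measure_ne_zero (Measure.haar : Measure (unipDelta L e dV hdV dW hdW)) Set.univ_nonempty
    rw [h0] at h1
    exact h1 rfl
  have hβ0 : ∫⁻ u, β u ∂(Measure.haar : Measure (unipDelta L e dV hdV dW hdW)) ≠ 0 :=
    lintegral_ne_zero_of_isCoveringWeight _ hν (unipDeltaRat L e dV hdV dW hdW) hβ
  obtain ⟨wq, hwq⟩ := K2LiuIntertwiningConvergesOfParabolic.exists_wq L e dV hdV dW hdW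
  -- the three carrier-dependent packages at this carrier
  obtain ⟨E, hEd, hEeq⟩ := hE (Measure.haar : Measure (unipDelta L e dV hdV dW hdW))
  obtain ⟨E₇, h7d, h7c, h7eq, h7g⟩ := hE₇ wq hwq (Measure.haar : Measure (unipDelta L e dV hdV dW hdW)) β hβ hβ0 hβtop K hK hβK
  obtain ⟨WT, GW, w, hWTd, hGWd, hw0, hws, hg, hRKW⟩ := hW (Measure.haar : Measure (unipDelta L e dV hdV dW hdW))
  -- ★ edition 8
  exact siegelEisensteinContinuation_eight L e dV hdV hdV0 dW hdW hdW0 lam hlam hw 𝒦 h𝒦 f hstd hcont Measure.haar β hβ hβ0 hβtop hK hβK wq hwq hS hur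
    E hEd hEeq E₇ h7d h7c h7eq h7g ι a had ρb ρa G hρb hG hGρ Eb Ea hEb hEa ua ub uG hua hub huG N₀ hN₀ hag hbg haG hws₁ (fun S hS0 hdet => hRK₁ S hS0 hdet)
    WT GW hWTd hGWd w hw0 hws hg hRKW

end Summit.HodgeConjecture.HodgeConjecture.Cruxes.HLiu418.K2LiuSiegelEisensteinContinuationTopNine

end
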